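import Literature.AlgebraicGeometry.Motives.PoincareUniversal.ModelTowerInstance
import Literature.AlgebraicGeometry.Motives.ThickeningLevelsAugmentation
import Literature.AlgebraicGeometry.Motives.ThickeningArtinianPoints
import Literature.AlgebraicGeometry.Motives.AbsoluteFlatModelTransition
import Literature.AlgebraicGeometry.Motives.DualNumberPoints
import Literature.AlgebraicGeometry.Modules.DetClassOfIso
import HarnessLib

/-!
# The dual-number chart points of `Â`: `Spec ℂ[ε] → Spec 𝒪_{Â,y₀}/𝔪^{m+1} → Â`, their classifying maps, the constant point

M13 node N3 (γ8, cell hodgecm-mathlib; author B-p07 (g12)), the DATA half of the injectivity of the Kodaira–Spencer maps of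
the Artinian charts of the Poincaré sheaf `𝒫` on `A₀ × Â` ([MumfordAV1970] §13, proof of the Theorem, pp. 125–130):

* `Yε = A₀ × Spec ℂ[ε]`; for a `ℂ`-algebra map `ψ : 𝒪_{Â,y₀}/𝔪^{m+1} → ℂ[ε]`: the chart point `uε ψ : Spec ℂ[ε] → Spec 𝒪/𝔪^{m+1}`,
  the `ℂ[ε]`-point `wε ψ : Spec ℂ[ε] → Â`, the classifying map `gε ψ : Yε → A₀ × Spec 𝒪/𝔪^{m+1}` (= the absolute transition
  morphism of `Motives/AbsoluteFlatModelTransition`), `gε_eq`, `gε_jBn`, and `pullbackGεIso : gε^*(𝒫|) ≅ (A₀ ◁ wε)^*𝒫`;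
* the `ℂ`-point `y₀pt` of the augmentation and `wε_constLift : wε (constLift ρ) = toUnit ≫ y₀pt`;
* `sliceMod y = 𝒫|_{A₀ × {y}}`, `hasRank_sliceMod`, `pullbackConstIso : (A₀ ◁ (toUnit ≫ y))^*𝒫 ≅ pr₁^*(𝒫_y)`;
* `left_eq_y₀pt_left` — a `ℂ`-point of `Â` through `y₀` is `y₀pt` (`ThickeningArtinianPoints.artinianFactor` +
  `ThickeningLevelsAugmentation.algHom_eq_ρℂ`); `maximalIdeal_dualNumber_pow_eq_bot`, `maximalIdeal_base_pow_eq_bot`.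

HC_CM is proved only modulo the 7 printed citations until rung 0 closes.

## References
* [MumfordAV1970] D. Mumford, *Abelian Varieties* (1970), §13 (proof of the Thm. pp. 125–130).
* [GortzWedhorn2020] U. Görtz, T. Wedhorn, *Algebraic Geometry I* (2nd ed.), (6.3)–(6.4) (tangent vectors as `k[ε]`-points).
-/

noncomputable section

universe u v

open TensorProduct CategoryTheory AlgebraicGeometry

namespace Literature.AlgebraicGeometry.Motives.AbelianVariety

open CategoryTheory CategoryTheory.Limits AlgebraicGeometry MonoidalCategory CartesianMonoidalCategory IsLocalRing
open Literature.AlgebraicGeometry.AbelianSchemes Literature.AlgebraicGeometry.AbelianVarieties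
  Literature.AlgebraicGeometry.Modules Literature.AlgebraicGeometry.Morphisms
  Literature.AlgebraicGeometry.Morphisms.CechUnitCocycle Literature.AlgebraicGeometry.Motives
open scoped DualNumber
open TrivSqZeroExt (fstHom)

section Gamma8

variable (A₀ : AbelianVariety ℂ) {Θ : CartierDivisor A₀.X.left} (hΘ : Θ.IsAmple)
  (P : (A₀.X ⊗ (A₀.dualOf Θ hΘ).X).left.Modules)
  {ι : Type} (V : ι → A₀.X.left.Opens) (hV : ∀ a, IsAffineOpen (V a))
  (y₀ : (A₀.dualOf Θ hΘ).X.left) [LocallyOfFiniteType (A₀.dualOf Θ hΘ).X.hom]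
  (hy₀ : IsClosed ({y₀} : Set (A₀.dualOf Θ hΘ).X.left))
  [IsSeparated A₀.X.hom]


/-- The structure morphism of `Spec ℂ[ε]` is `Spec (ℂ → ℂ[ε])` (definitional; the `hs` of the absolute model).
[cite: GortzWedhorn2020, (6.3)–(6.4)] -/
theorem dualNumberOver_hom : dualNumberOver.hom = Spec.map (CommRingCat.ofHom (algebraMap ℂ ℂ[ε])) := rfl

/-- `Spec (ℂ → ℂ) = 𝟙`. [cite: MumfordAV1970, §13 (proof of the Thm. pp. 125–130)] -/
theorem specMap_algebraMap_self : Spec.map (CommRingCat.ofHom (algebraMap ℂ ℂ)) = 𝟙 _ := by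
  rw [Algebra.algebraMap_self, CommRingCat.ofHom_id]
  exact Spec.map_id _

/-- `(ε)^{k+2} = 0` in `ℂ[ε]`. [cite: MumfordAV1970, §13 (proof of the Thm. pp. 125–130)] -/
theorem maximalIdeal_dualNumber_pow_eq_bot (k : ℕ) : maximalIdeal ℂ[ε] ^ (k + 2) = ⊥ := by
  have h2 : maximalIdeal ℂ[ε] ^ 2 = ⊥ := by
    rw [DualNumber.maximalIdeal_eq_span_singleton_eps, Ideal.span_singleton_pow, pow_two, DualNumber.eps_mul_eps,
      Ideal.span_singleton_eq_bot]
  exact le_bot_iff.mp ((Ideal.pow_le_pow_right (Nat.le_add_left 2 k)).trans h2.le)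

/-- `𝔪_ℂ^{k+1} = 0`. [cite: MumfordAV1970, §13 (proof of the Thm. pp. 125–130)] -/
theorem maximalIdeal_base_pow_eq_bot (k : ℕ) : maximalIdeal ℂ ^ (k + 1) = ⊥ := by
  rw [(IsLocalRing.isField_iff_maximalIdeal_eq).mp (Field.toIsField ℂ), ← Ideal.zero_eq_bot, zero_pow
    (Nat.succ_ne_zero k)]

/-- `A₀ × Spec ℂ[ε]`. [cite: MumfordAV1970, §13 (proof of the Thm. pp. 125–130)] -/
abbrev Yε : Scheme := pullback A₀.X.hom dualNumberOver.hom

/-- **The chart point `Spec ℂ[ε] → Spec 𝒪_{Â,y₀}/𝔪^{m+1}` of a `ℂ`-algebra map `ψ : 𝒪_{Â,y₀}/𝔪^{m+1} → ℂ[ε]`** as a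
`ℂ`-morphism. [cite: MumfordAV1970, §13 (proof of the Thm. pp. 125–130)] -/
def uε (m : ℕ) (ψ : Rt (A₀.dualOf Θ hΘ).X y₀ m →ₐ[ℂ] ℂ[ε]) :
    dualNumberOver ⟶ thickeningPt (A₀.dualOf Θ hΘ).X y₀ m :=
  Over.homMk (Spec.map (CommRingCat.ofHom ψ.toRingHom))
    (Spec_map_comp_eq_of_algHom (sB A₀ hΘ y₀ m) (thickeningPt_hom_eq (A₀.dualOf Θ hΘ).X y₀ m)
      dualNumberOver.hom dualNumberOver_hom ψ)

/-- The `ℂ[ε]`-point `Spec ℂ[ε] → Spec 𝒪_{Â,y₀}/𝔪^{m+1} → Â` of `ψ`. [cite: MumfordAV1970, §13 (proof of the Thm. pp. 125–130)] -/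
def wε (m : ℕ) (ψ : Rt (A₀.dualOf Θ hΘ).X y₀ m →ₐ[ℂ] ℂ[ε]) : dualNumberOver ⟶ (A₀.dualOf Θ hΘ).X :=
  uε A₀ hΘ y₀ m ψ ≫ thickeningPtι (A₀.dualOf Θ hΘ).X y₀ m

omit [LocallyOfFiniteType (A₀.dualOf Θ hΘ).X.hom] [IsSeparated A₀.X.hom] in
/-- The scheme morphism underlying `wε`. [cite: MumfordAV1970, §13 (proof of the Thm. pp. 125–130)] -/
theorem wε_left (m : ℕ) (ψ : Rt (A₀.dualOf Θ hΘ).X y₀ m →ₐ[ℂ] ℂ[ε]) :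
    (wε A₀ hΘ y₀ m ψ).left =
      Spec.map (CommRingCat.ofHom ψ.toRingHom) ≫ (thickeningPtι (A₀.dualOf Θ hΘ).X y₀ m).left :=
  rfl

/-- **The classifying map `A₀ × Spec ℂ[ε] → A₀ × Spec 𝒪_{Â,y₀}/𝔪^{m+1}` of `ψ`** (the absolute transition morphism).
[cite: MumfordAV1970, §13 (proof of the Thm. pp. 125–130)] -/
def gε (m : ℕ) (ψ : Rt (A₀.dualOf Θ hΘ).X y₀ m →ₐ[ℂ] ℂ[ε]) : Yε A₀ ⟶ YBn A₀ hΘ y₀ m :=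
  absTransition A₀.X (sB A₀ hΘ y₀ m) (thickeningPt_hom_eq (A₀.dualOf Θ hΘ).X y₀ m) dualNumberOver.hom
    dualNumberOver_hom ψ

omit [LocallyOfFiniteType (A₀.dualOf Θ hΘ).X.hom] [IsSeparated A₀.X.hom] in
/-- `gε = (A₀ ◁ uε).left`. [cite: MumfordAV1970, §13 (proof of the Thm. pp. 125–130)] -/
theorem gε_eq (m : ℕ) (ψ : Rt (A₀.dualOf Θ hΘ).X y₀ m →ₐ[ℂ] ℂ[ε]) :
    (A₀.X ◁ uε A₀ hΘ y₀ m ψ).left = gε A₀ hΘ y₀ m ψ :=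
  whiskerLeft_left_eq_absTransition A₀.X (sB A₀ hΘ y₀ m) (thickeningPt_hom_eq (A₀.dualOf Θ hΘ).X y₀ m)
    dualNumberOver.hom dualNumberOver_hom ψ (uε A₀ hΘ y₀ m ψ) rfl

omit [LocallyOfFiniteType (A₀.dualOf Θ hΘ).X.hom] [IsSeparated A₀.X.hom] in
/-- `gε ≫ jB = (A₀ ◁ wε).left`. [cite: MumfordAV1970, §13 (proof of the Thm. pp. 125–130)] -/
theorem gε_jBn (m : ℕ) (ψ : Rt (A₀.dualOf Θ hΘ).X y₀ m →ₐ[ℂ] ℂ[ε]) :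
    gε A₀ hΘ y₀ m ψ ≫ jBn A₀ hΘ y₀ m = (A₀.X ◁ wε A₀ hΘ y₀ m ψ).left := by
  rw [← gε_eq, jBn, wε, MonoidalCategory.whiskerLeft_comp, Over.comp_left]
  rfl

/-- **`gε^*(𝒫|_{A₀ × Spec B}) ≅ (A₀ ◁ wε)^*𝒫`.** [cite: MumfordAV1970, §13 (proof of the Thm. pp. 125–130)] -/
def pullbackGεIso (m : ℕ) (ψ : Rt (A₀.dualOf Θ hΘ).X y₀ m →ₐ[ℂ] ℂ[ε]) :
    (Scheme.Modules.pullback (gε A₀ hΘ y₀ m ψ)).obj (PBn A₀ hΘ P y₀ m) ≅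
      (Scheme.Modules.pullback (A₀.X ◁ wε A₀ hΘ y₀ m ψ).left).obj P :=
  ((Scheme.Modules.pullbackComp (gε A₀ hΘ y₀ m ψ) (jBn A₀ hΘ y₀ m)).app P) ≪≫
    eqToIso (congrArg (fun k => (Scheme.Modules.pullback k).obj P) (gε_jBn A₀ hΘ y₀ m ψ))

/-- **The `ℂ`-point `Spec ℂ → Spec 𝒪_{Â,y₀}/𝔪^{m+1}` of the augmentation** (the chart point of `ρ`).
[cite: MumfordAV1970, §13 (proof of the Thm. pp. 125–130)] -/
def y₀chart (m : ℕ) : 𝟙_ (SchemeOver ℂ) ⟶ thickeningPt (A₀.dualOf Θ hΘ).X y₀ m :=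
  Over.homMk (Spec.map (CommRingCat.ofHom (ρℂ (A₀.dualOf Θ hΘ).X y₀ hy₀ m).toRingHom)) (by
    rw [tensorUnit_hom, ← specMap_algebraMap_self]
    exact Spec_map_comp_eq_of_algHom (sB A₀ hΘ y₀ m) (thickeningPt_hom_eq (A₀.dualOf Θ hΘ).X y₀ m)
      (Spec.map (CommRingCat.ofHom (algebraMap ℂ ℂ))) rfl (ρℂ (A₀.dualOf Θ hΘ).X y₀ hy₀ m))

omit [IsSeparated A₀.X.hom] in
/-- The scheme morphism underlying `y₀chart`. [cite: MumfordAV1970, §13 (proof of the Thm. pp. 125–130)] -/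
theorem y₀chart_left (m : ℕ) :
    (y₀chart A₀ hΘ y₀ hy₀ m).left = Spec.map (CommRingCat.ofHom (ρℂ (A₀.dualOf Θ hΘ).X y₀ hy₀ m).toRingHom) :=
  rfl

/-- **The `ℂ`-point `Spec ℂ → Spec 𝒪_{Â,y₀}/𝔪^{m+1} → Â` of the augmentation** (the point `y₀`).
[cite: MumfordAV1970, §13 (proof of the Thm. pp. 125–130)] -/
def y₀pt (m : ℕ) : 𝟙_ (SchemeOver ℂ) ⟶ (A₀.dualOf Θ hΘ).X :=
  y₀chart A₀ hΘ y₀ hy₀ m ≫ thickeningPtι (A₀.dualOf Θ hΘ).X y₀ m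

omit [IsSeparated A₀.X.hom] in
/-- The scheme morphism underlying `y₀pt`. [cite: MumfordAV1970, §13 (proof of the Thm. pp. 125–130)] -/
theorem y₀pt_left (m : ℕ) :
    (y₀pt A₀ hΘ y₀ hy₀ m).left = Spec.map (CommRingCat.ofHom (ρℂ (A₀.dualOf Θ hΘ).X y₀ hy₀ m).toRingHom) ≫
      (thickeningPtι (A₀.dualOf Θ hΘ).X y₀ m).left :=
  rfl

omit [IsSeparated A₀.X.hom] in
/-- The chart point of the constant lift is constant: `uε (constLift ρ) = toUnit ≫ y₀chart`. [cite: MumfordAV1970, §13 (proof of the Thm. pp. 125–130)] -/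
theorem uε_constLift (m : ℕ) :
    uε A₀ hΘ y₀ m (constLift (ρℂ (A₀.dualOf Θ hΘ).X y₀ hy₀ m)) = toUnit _ ≫ y₀chart A₀ hΘ y₀ hy₀ m := by
  apply Over.OverMorphism.ext
  rw [Over.comp_left, toUnit_left, y₀chart_left, dualNumberOver_hom, uε]
  exact Spec.map_comp (CommRingCat.ofHom (ρℂ (A₀.dualOf Θ hΘ).X y₀ hy₀ m).toRingHom)
    (CommRingCat.ofHom (algebraMap ℂ ℂ[ε]))

omit [IsSeparated A₀.X.hom] in
/-- **The `ℂ[ε]`-point of the constant lift is constant:** `wε (constLift ρ) = toUnit ≫ y₀pt`. [cite: MumfordAV1970, §13 (proof of the Thm. pp. 125–130)] -/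
theorem wε_constLift (m : ℕ) :
    wε A₀ hΘ y₀ m (constLift (ρℂ (A₀.dualOf Θ hΘ).X y₀ hy₀ m)) = toUnit _ ≫ y₀pt A₀ hΘ y₀ hy₀ m := by
  rw [wε, uε_constLift, Category.assoc]
  rfl

omit [LocallyOfFiniteType (A₀.dualOf Θ hΘ).X.hom] [IsSeparated A₀.X.hom] in
/-- `A₀ ◁ (toUnit S ≫ y) = pr₁ ≫ (ρ⁻¹ ≫ A₀ ◁ y)` on underlying schemes. [cite: MumfordAV1970, §13 (proof of the Thm. pp. 125–130)] -/
theorem whiskerLeft_toUnit_comp_left (S : SchemeOver ℂ) (y : 𝟙_ (SchemeOver ℂ) ⟶ (A₀.dualOf Θ hΘ).X) :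
    (A₀.X ◁ (toUnit S ≫ y)).left =
      (CartesianMonoidalCategory.fst A₀.X S).left ≫ ((ρ_ A₀.X).inv ≫ A₀.X ◁ y).left := by
  have h : A₀.X ◁ toUnit S = CartesianMonoidalCategory.fst A₀.X S ≫ (ρ_ A₀.X).inv := by
    rw [← whiskerLeft_toUnit_comp_rightUnitor_hom, Category.assoc, Iso.hom_inv_id, Category.comp_id]
  rw [MonoidalCategory.whiskerLeft_comp, h, Category.assoc, Over.comp_left]

/-- The slice `𝒫|_{A₀ × {y}}` of `𝒫` at a `ℂ`-point `y` of `Â`, as a module on `A₀`. [cite: MumfordAV1970, §13 (p. 125)] -/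
def sliceMod (y : 𝟙_ (SchemeOver ℂ) ⟶ (A₀.dualOf Θ hΘ).X) : A₀.X.left.Modules :=
  (Scheme.Modules.pullback ((ρ_ A₀.X).inv ≫ A₀.X ◁ y).left).obj P

omit [LocallyOfFiniteType (A₀.dualOf Θ hΘ).X.hom] [IsSeparated A₀.X.hom] in
/-- The slice of a rank-one `𝒫` has rank one. [cite: MumfordAV1970, §13 (proof of the Thm. pp. 125–130)] -/
theorem hasRank_sliceMod (hP1 : HasRank P 1) (y : 𝟙_ (SchemeOver ℂ) ⟶ (A₀.dualOf Θ hΘ).X) :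
    HasRank (sliceMod A₀ hΘ P y) 1 :=
  hasRank_pullback _ hP1

/-- **`(A₀ ◁ (toUnit ≫ y))^*𝒫 ≅ pr₁^*(𝒫_y)`**: a constant `S`-point gives a constant deformation. [cite: MumfordAV1970, §13 (proof of the Thm. pp. 125–130)] -/
def pullbackConstIso (S : SchemeOver ℂ) (y : 𝟙_ (SchemeOver ℂ) ⟶ (A₀.dualOf Θ hΘ).X) :
    (Scheme.Modules.pullback (A₀.X ◁ (toUnit S ≫ y)).left).obj P ≅
      (Scheme.Modules.pullback (CartesianMonoidalCategory.fst A₀.X S).left).obj (sliceMod A₀ hΘ P y) :=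
  eqToIso (congrArg (fun k => (Scheme.Modules.pullback k).obj P) (whiskerLeft_toUnit_comp_left A₀ hΘ S y)) ≪≫
    ((Scheme.Modules.pullbackComp (CartesianMonoidalCategory.fst A₀.X S).left
      ((ρ_ A₀.X).inv ≫ A₀.X ◁ y).left).app P).symm

omit [IsSeparated A₀.X.hom] in
/-- **`ℂ`-points of `Â` through `y₀` are unique**: a `ℂ`-point `y : Spec ℂ → Â` hitting `y₀` is `y₀pt` (both factor
through `Spec 𝒪_{Â,y₀}/𝔪^{m+1}` by α7, and all `ℂ`-algebra maps `𝒪/𝔪^{m+1} → ℂ` are `ρ`). [cite: MumfordAV1970, §13 (proof of the Thm. pp. 125–130)] -/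
theorem left_eq_y₀pt_left (m : ℕ) (y : 𝟙_ (SchemeOver ℂ) ⟶ (A₀.dualOf Θ hΘ).X)
    (hy : y.left (closedPoint ℂ) = y₀) : y.left = (y₀pt A₀ hΘ y₀ hy₀ m).left := by
  have hgK : y.left ≫ (A₀.dualOf Θ hΘ).X.hom = Spec.map (CommRingCat.ofHom (algebraMap ℂ ℂ)) := by
    rw [specMap_algebraMap_self, Over.w y, tensorUnit_hom]
  have h1 := Spec_map_artinianFactor (A₀.dualOf Θ hΘ).X (topPt (A₀.dualOf Θ hΘ).X y₀) y.left hy hgK m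
    (maximalIdeal_base_pow_eq_bot m)
  rw [algHom_eq_ρℂ (A₀.dualOf Θ hΘ).X y₀ hy₀ m (artinianFactor _ _ y.left hy hgK m _)] at h1
  rw [← h1, y₀pt_left]

end Gamma8

end Literature.AlgebraicGeometry.Motives.AbelianVariety

end
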